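import Summits.BirchSwinnertonDyer.BirchSwinnertonDyer.Theses.TameQuarticManinParity
import Summits.BirchSwinnertonDyer.BirchSwinnertonDyer.Theorems.TameQuarticManinParityTwistPartnerOptimalDatumOfFacts
import Literature.NumberTheory.EllipticCurves.IsogenyPotentiallyGoodMinimalDiscriminantProofs
import HarnessLib

/-!
# Route `TameQuarticManinParity`, LINE 24 (bsd-idea-3 g8): X22m `TprimeIrrTwistPartnerOptimalDatumOfModularity`
# (stmt-BirchSwinnertonDyer-22547) — X22 RELATIVE TO MODULARITY ALONE, closed by name

Cell `pub/bsd-wall`, D-0145 line `route-BirchSwinnertonDyer-TeichmullerTwistDescent`, seat `bsd-line-ttd-p1` g11,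
working the planner-of-record's TQMP LINE 24. BSD is NOT proved by this; Manin's conjecture at 3 is not proved; X22
`TprimeIrrTwistPartnerOptimalDatum` (stmt-28190) itself stays as typed (it is modularity-dependent, like every BSD
leaf).

The landed conditional theorem `tprimeIrrTwistPartnerOptimalDatum_of_modularity_of_dokchitser` (seat g10,
`TameQuarticManinParityTwistPartnerOptimalDatumOfFacts`) proves X22 from TWO named facts: modularity
(`exists_isNewformOf`, BCDT 2001 Thm. A, cite-only) and Dokchitser–Dokchitser 2015 Thm. 5.1 (1)
(`dokchitser_padicValInt_minimalDiscriminantInt_eq_of_isogeny_of_not_dvd_degree`: an isogeny of degree prime to `p`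
preserves `ord_p Δ_min` at a potentially good `p`). The second is NOT an open input: it is DISCHARGED in the tree
(`dokchitser_padicValInt_minimalDiscriminantInt_eq_of_isogeny_of_not_dvd_degree_holds`,
`Literature/NumberTheory/EllipticCurves/IsogenyPotentiallyGoodMinimalDiscriminantProofs.lean`, seat bsd-line-ttd-p2 g5:
good reduction over `ℚ(E[3])` / `ℚ(E[4])` + integrality of the isogeny multiplier between minimal models, both ways).
Hence X22 follows from modularity ALONE, which is exactly the route item X22m. Design: one composition by name; no
definition, no named-fact hypothesis beyond the item's own binder, no `sorry`; axioms `propext`, `Classical.choice`,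
`Quot.sound`.
-/

set_option autoImplicit false
-- D-0017: single-problem summit, so `Summit.BirchSwinnertonDyer.BirchSwinnertonDyer.…` repeats a namespace BY DESIGN.
set_option linter.dupNamespace false

noncomputable section

namespace Summit.BirchSwinnertonDyer.BirchSwinnertonDyer.Theorems.TameQuarticManinParity

open Summit.BirchSwinnertonDyer.BirchSwinnertonDyer.Theses.TameQuarticManinParity
open Literature.NumberTheory.EllipticCurves Literature.NumberTheory.EllipticCurves.ModularForms

/-- **X22 from modularity alone**: for `W/ℚ` globally minimal, non-CM, in the tame quartic cell (t′) at `3` with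
`E[3]` irreducible, granted `exists_isNewformOf` there is a globally minimal `A` with `A ⊗ χ₋₃ ∼ W` of the opposite
Kodaira type at `3`, non-CM, (t′), `E[3]`-irreducible, `N(A) = N(W)`, carrying a lattice-optimal degree-minimal
conductor-level datum. Dokchitser–Dokchitser 2015 Thm. 5.1 (1) enters as the tree's THEOREM
`dokchitser_padicValInt_minimalDiscriminantInt_eq_of_isogeny_of_not_dvd_degree_holds`.
[cite: BCDTJAMS2001, Thm. A] [cite: DokchitserDokchitser2015LocalInvariants, Thm. 5.1 (1)] -/
theorem tprimeIrrTwistPartnerOptimalDatum_of_modularity (hnf : exists_isNewformOf) :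
    TprimeIrrTwistPartnerOptimalDatum :=
  tprimeIrrTwistPartnerOptimalDatum_of_modularity_of_dokchitser hnf
    dokchitser_padicValInt_minimalDiscriminantInt_eq_of_isogeny_of_not_dvd_degree_holds

/-- **X22m `TprimeIrrTwistPartnerOptimalDatumOfModularity` (stmt-BirchSwinnertonDyer-22547), closed by name**:
`exists_isNewformOf → TprimeIrrTwistPartnerOptimalDatum`. [cite: BCDTJAMS2001, Thm. A]
[cite: DokchitserDokchitser2015LocalInvariants, Thm. 5.1 (1)] -/
theorem tprimeIrrTwistPartnerOptimalDatumOfModularity_proof : TprimeIrrTwistPartnerOptimalDatumOfModularity := by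
  unfold TprimeIrrTwistPartnerOptimalDatumOfModularity
  exact tprimeIrrTwistPartnerOptimalDatum_of_modularity

end Summit.BirchSwinnertonDyer.BirchSwinnertonDyer.Theorems.TameQuarticManinParity

end
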